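import Summits.Ventures.Crystal3D.Theorems.StickyWulffConstantNoReconstructionGainJointBoundLevelDefs
import HarnessLib

/-!
# Joint level/support bound — from the certified table to arcs, and the assembly of the rules

HONEST FRAMING. Part of the venture `Summits/Ventures/Crystal3D` (cell `crystal3d-full`), helper
`--supports` the crux `NoReconstructionGain` (stmt-Ventures-19144, route
`route-Ventures-StickyWulffConstant`), line `joint-level-support-bound`, stub
`stub_jointBound_levelHeavy20` (skeleton v2).

* `jb_arcC`, `jb_arcA`, `jb_arcLL` — the certified table entries (`…JointBoundLevelDefs`) as angular
  separations: a `1/20`-level direction is at azimuthal distance `≥ jbTC b · 10⁻⁴` from a deep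
  direction of band `b`; two deep directions of bands `i, j` (positive horizontal radii) are
  `> jbTA i j · 10⁻⁴` apart; two level directions are `> jbTLL · 10⁻⁴` apart.
* `jbTupleOK_sound` — the Boolean tuple check unfolded into its three integer inequalities.
* `jb_assembly` — the bookkeeping: the consecutive deep gaps, the ten packing inequalities of the level
  counts, the weighted-cycle inequality and a true tuple check are contradictory (`2π·10⁴ < 62832`).

WHAT THIS IS NOT: the geometric theorem (see `…JointBoundLevelHeavy`); rung F-C1 not moved.
-/

noncomputable section

namespace Summit.Ventures.Crystal3D.Theorems

open Finset Real

/-! ### Band edges -/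

/-- Every lower band edge is at least `1/2`. -/
theorem jbLo_ge_half (b : ℕ) : (1 : ℚ) / 2 ≤ jbLo b := by
  unfold jbLo
  rcases b with _ | _ | _ | _ | _ | _ | _ | _ | b <;> simp <;> norm_num

/-! ### Arcs from the certificates -/

/-- **Clearance arc, strict form** for a band with nonzero clearance. -/
theorem jb_arcC_lt (b : ℕ) (hb : b < 8) (hb0 : jbTC b ≠ 0) (z₁ z₂ ρ₁ ρ₂ x : ℝ)
    (hz₁ : z₁ ≤ -(1 / 2)) (hz₁' : -((jbHi b : ℚ) : ℝ) ≤ z₁) (hz₂ : |z₂| ≤ 1 / 20) (hρ₁ : 0 ≤ ρ₁)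
    (hρ₂ : 0 ≤ ρ₂) (e₁ : z₁ ^ 2 + ρ₁ ^ 2 = 1) (e₂ : z₂ ^ 2 + ρ₂ ^ 2 = 1) (hx : 0 ≤ x)
    (hsep : ρ₁ * ρ₂ * Real.cos x + z₁ * z₂ ≤ 1 / 2) : ((jbTC b : ℕ) : ℝ) / 10000 < x := by
  have hcert := jb_certs.1 b hb
  simp only [jbCertC, Bool.or_eq_true, beq_iff_eq, Bool.and_eq_true, decide_eq_true_eq] at hcert
  rcases hcert with h0 | ⟨⟨hτ3, hc⟩, hcond⟩
  · exact absurd h0 hb0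
  set τq : ℚ := (jbTC b : ℚ) / 10000 with hτq
  have hτ : ((τq : ℚ) : ℝ) = ((jbTC b : ℕ) : ℝ) / 10000 := by rw [hτq]; push_cast; ring
  have hcR : (0 : ℝ) < ((cosLB τq : ℚ) : ℝ) := by exact_mod_cast hc
  have hcondR : ((1 : ℝ) / 2 + ((jbHi b : ℚ) : ℝ) / 20) ^ 2 <
      ((cosLB τq : ℚ) : ℝ) ^ 2 * (399 / 400) * (1 - ((jbHi b : ℚ) : ℝ) ^ 2) := by
    have := (Rat.cast_lt (K := ℝ)).2 hcond; push_cast at this; exact this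
  have hτπ : ((τq : ℚ) : ℝ) ≤ π := by
    have := (Rat.cast_le (K := ℝ)).2 hτ3; push_cast at this; linarith [Real.pi_gt_three]
  have hcos := cosLB_le_cos τq
  rw [← hτ]
  by_contra hle
  push Not at hle
  have hcx : ((cosLB τq : ℚ) : ℝ) ≤ Real.cos x :=
    hcos.trans (Real.cos_le_cos_of_nonneg_of_le_pi hx hτπ hle)
  have key := sep_level_core20 _ _ (-z₁) z₂ ρ₁ ρ₂ hcR hcondR (by linarith) (by linarith) hz₂ hρ₁ hρ₂
    (by nlinarith) e₂
  have : ((cosLB τq : ℚ) : ℝ) * (ρ₁ * ρ₂) ≤ ρ₁ * ρ₂ * Real.cos x := by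
    nlinarith [mul_nonneg hρ₁ hρ₂]
  nlinarith

/-- **Clearance arc** (non-strict form, valid also for transparent bands). -/
theorem jb_arcC (b : ℕ) (hb : b < 8) (z₁ z₂ ρ₁ ρ₂ x : ℝ) (hz₁ : z₁ ≤ -(1 / 2))
    (hz₁' : -((jbHi b : ℚ) : ℝ) ≤ z₁) (hz₂ : |z₂| ≤ 1 / 20) (hρ₁ : 0 ≤ ρ₁) (hρ₂ : 0 ≤ ρ₂)
    (e₁ : z₁ ^ 2 + ρ₁ ^ 2 = 1) (e₂ : z₂ ^ 2 + ρ₂ ^ 2 = 1) (hx : 0 ≤ x)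
    (hsep : ρ₁ * ρ₂ * Real.cos x + z₁ * z₂ ≤ 1 / 2) : ((jbTC b : ℕ) : ℝ) / 10000 ≤ x := by
  by_cases hb0 : jbTC b = 0
  · rw [hb0]; simp; exact hx
  · exact (jb_arcC_lt b hb hb0 z₁ z₂ ρ₁ ρ₂ x hz₁ hz₁' hz₂ hρ₁ hρ₂ e₁ e₂ hx hsep).le

/-- Every clearance entry is at most `8767`. -/
theorem jbTC_le (b : ℕ) : jbTC b ≤ 8767 := by
  unfold jbTC
  rcases b with _ | _ | _ | _ | _ | _ | _ | _ | b <;> simp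

/-- **Deep–deep arc.**  Two deep directions of bands `i, j` (`zₖ ≤ -jbLo`, positive horizontal radii)
whose azimuths differ by `x ≥ 0` with `ρ₁ ρ₂ cos x + z₁ z₂ ≤ 1/2` satisfy `jbTA i j · 10⁻⁴ < x`. -/
theorem jb_arcA (i j : ℕ) (hi : i < 8) (hj : j < 8) (z₁ z₂ ρ₁ ρ₂ x : ℝ)
    (hz₁ : z₁ ≤ -((jbLo i : ℚ) : ℝ)) (hz₂ : z₂ ≤ -((jbLo j : ℚ) : ℝ)) (hρ₁ : 0 < ρ₁) (hρ₂ : 0 < ρ₂)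
    (e₁ : z₁ ^ 2 + ρ₁ ^ 2 = 1) (e₂ : z₂ ^ 2 + ρ₂ ^ 2 = 1) (hx : 0 ≤ x)
    (hsep : ρ₁ * ρ₂ * Real.cos x + z₁ * z₂ ≤ 1 / 2) : ((jbTA i j : ℕ) : ℝ) / 10000 < x := by
  have hcert := jb_certs.2.1 i hi j hj
  simp only [jbCertA, Bool.or_eq_true, Bool.and_eq_true, decide_eq_true_eq] at hcert
  obtain ⟨hτ3, hcase⟩ := hcert
  set τq : ℚ := (jbTA i j : ℚ) / 10000 with hτq
  have hτ : ((τq : ℚ) : ℝ) = ((jbTA i j : ℕ) : ℝ) / 10000 := by rw [hτq]; push_cast; ring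
  have hτπ : ((τq : ℚ) : ℝ) ≤ π := by
    have := (Rat.cast_le (K := ℝ)).2 hτ3; push_cast at this; linarith [Real.pi_gt_three]
  have hcos := cosLB_le_cos τq
  have hlo_i : (1 : ℝ) / 2 ≤ ((jbLo i : ℚ) : ℝ) := by
    have := (Rat.cast_le (K := ℝ)).2 (jbLo_ge_half i); push_cast at this; exact this
  have hlo_j : (1 : ℝ) / 2 ≤ ((jbLo j : ℚ) : ℝ) := by
    have := (Rat.cast_le (K := ℝ)).2 (jbLo_ge_half j); push_cast at this; exact this
  rw [← hτ]
  by_contra hle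
  push Not at hle
  have hcx : ((cosLB τq : ℚ) : ℝ) ≤ Real.cos x :=
    hcos.trans (Real.cos_le_cos_of_nonneg_of_le_pi hx hτπ hle)
  have hprod : ((cosLB τq : ℚ) : ℝ) * (ρ₁ * ρ₂) ≤ ρ₁ * ρ₂ * Real.cos x := by
    nlinarith [mul_pos hρ₁ hρ₂]
  rcases hcase with ⟨hc, hacute⟩ | ⟨hp, hobt⟩
  · have hcR : (0 : ℝ) < ((cosLB τq : ℚ) : ℝ) := by exact_mod_cast hc
    have hcondR : (1 : ℝ) / 2 ≤ ((jbLo i : ℚ) : ℝ) * ((jbLo j : ℚ) : ℝ) ∨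
        (1 / 2 - ((jbLo i : ℚ) : ℝ) * ((jbLo j : ℚ) : ℝ)) ^ 2 <
          ((cosLB τq : ℚ) : ℝ) ^ 2 * (1 - ((jbLo i : ℚ) : ℝ) ^ 2) * (1 - ((jbLo j : ℚ) : ℝ) ^ 2) := by
      rcases hacute with h | h
      · left; have := (Rat.cast_le (K := ℝ)).2 h; push_cast at this; exact this
      · right; have := (Rat.cast_lt (K := ℝ)).2 h; push_cast at this; exact this
    have key := sep_deep_core2 _ _ _ (-z₁) (-z₂) ρ₁ ρ₂ hcR hlo_i hlo_j hcondR (by linarith)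
      (by linarith) hρ₁ hρ₂ (by nlinarith) (by nlinarith)
    nlinarith
  · have hpR : (1 : ℝ) / 2 < ((jbLo i : ℚ) : ℝ) * ((jbLo j : ℚ) : ℝ) := by
      have := (Rat.cast_lt (K := ℝ)).2 hp; push_cast at this; exact this
    have hobtR : ((cosLB τq : ℚ) : ℝ) ^ 2 * (1 - ((jbLo i : ℚ) : ℝ) ^ 2) * (1 - ((jbLo j : ℚ) : ℝ) ^ 2)
        < (((jbLo i : ℚ) : ℝ) * ((jbLo j : ℚ) : ℝ) - 1 / 2) ^ 2 := by
      have := (Rat.cast_lt (K := ℝ)).2 hobt; push_cast at this; exact this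
    have key := sep_deep_core_obtuse _ _ _ (-z₁) (-z₂) ρ₁ ρ₂ (by linarith) (by linarith) hpR hobtR
      (by linarith) (by linarith) (by nlinarith) (by nlinarith)
    nlinarith

/-- **Level–level arc.**  Two `1/20`-level directions whose azimuths differ by `x ≥ 0` with
`ρ₁ ρ₂ cos x + z₁ z₂ ≤ 1/2` satisfy `jbTLL · 10⁻⁴ < x`. -/
theorem jb_arcLL (z₁ z₂ ρ₁ ρ₂ x : ℝ) (hz₁ : |z₁| ≤ 1 / 20) (hz₂ : |z₂| ≤ 1 / 20) (hρ₁ : 0 ≤ ρ₁)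
    (hρ₂ : 0 ≤ ρ₂) (e₁ : z₁ ^ 2 + ρ₁ ^ 2 = 1) (e₂ : z₂ ^ 2 + ρ₂ ^ 2 = 1) (hx : 0 ≤ x)
    (hsep : ρ₁ * ρ₂ * Real.cos x + z₁ * z₂ ≤ 1 / 2) : ((jbTLL : ℕ) : ℝ) / 10000 < x := by
  have hcert := jb_certs.2.2
  simp only [jbCertLL, Bool.and_eq_true, decide_eq_true_eq] at hcert
  obtain ⟨hτ3, hc⟩ := hcert
  set τq : ℚ := (jbTLL : ℚ) / 10000 with hτq
  have hτ : ((τq : ℚ) : ℝ) = ((jbTLL : ℕ) : ℝ) / 10000 := by rw [hτq]; push_cast; ring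
  have hτπ : ((τq : ℚ) : ℝ) ≤ π := by
    have := (Rat.cast_le (K := ℝ)).2 hτ3; push_cast at this; linarith [Real.pi_gt_three]
  have hcos := cosLB_le_cos τq
  have hcR : (201 : ℝ) / 399 < ((cosLB τq : ℚ) : ℝ) := by
    have := (Rat.cast_lt (K := ℝ)).2 hc; push_cast at this; exact this
  rw [← hτ]
  by_contra hle
  push Not at hle
  have hcx : ((cosLB τq : ℚ) : ℝ) ≤ Real.cos x :=
    hcos.trans (Real.cos_le_cos_of_nonneg_of_le_pi hx hτπ hle)
  have key := sep_level_level_core20 _ z₁ z₂ ρ₁ ρ₂ hcR hz₁ hz₂ hρ₁ hρ₂ e₁ e₂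
  have : ((cosLB τq : ℚ) : ℝ) * (ρ₁ * ρ₂) ≤ ρ₁ * ρ₂ * Real.cos x := by
    have : (0:ℝ) < ((cosLB τq : ℚ) : ℝ) := by linarith
    nlinarith [mul_nonneg hρ₁ hρ₂]
  nlinarith

/-! ### Unfolding the tuple check -/

/-- The tuple check, unfolded for a particular level distribution. -/
theorem jbTupleOK_sound (bs b1 b2 b3 k0 k1 k2 : ℕ) (hk0 : k0 < 6) (hk1 : k1 < 6) (hk2 : k2 < 6)
    (hsum : k0 + k1 + k2 ≤ 5) (h : jbTupleOK bs b1 b2 b3 = true) :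
    62832 ≤ jbRA (jbTC bs) (jbTC b1) (jbTC b2) (jbTC b3) ∨
    62832 ≤ jbHostAll (jbTA bs b1) (jbTA b1 b2) (jbTA b2 b3) (jbTA b3 bs)
      (jbTC bs) (jbTC b1) (jbTC b2) (jbTC b3) k0 k1 k2 (5 - (k0 + k1 + k2) : ℕ) ∨
    62832 ≤ jbHostF (jbFlag (jbTC b1)) (jbFlag (jbTC b2)) (jbFlag (jbTC b3))
      (jbTA bs b1) (jbTA b1 b2) (jbTA b2 b3) (jbTA b3 bs)
      (jbTC bs) (jbTC b1) (jbTC b2) (jbTC b3) k0 k1 k2 (5 - (k0 + k1 + k2) : ℕ) := by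
  simp only [jbTupleOK, Bool.or_eq_true, decide_eq_true_eq, List.all_eq_true, List.mem_range,
    Bool.not_eq_true', decide_eq_false_iff_not] at h
  rcases h with h | h
  · exact Or.inl h
  · have h' := h k0 hk0 k1 hk1 k2 hk2
    rcases h' with h' | h'
    · exact absurd hsum h'
    · simp only [jbHostOK, Bool.or_eq_true, decide_eq_true_eq] at h'
      exact Or.inr h'

/-! ### Assembly of the rules -/

/-- One deep arc (a block) hosting `K` levels is at least `jbBlock` long. -/
theorem jbBlock_le (A : ℤ) (K c c' : ℕ) (g : ℝ) (hA0 : 0 ≤ A) (hA : (A : ℝ) < g)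
    (hP : 1 ≤ K → ((c : ℝ) + c') + ((K : ℝ) - 1) * (jbTLL : ℝ) ≤ g) :
    ((jbBlock A K c c' : ℤ) : ℝ) ≤ g := by
  have hg : 0 ≤ g := by
    have : (0 : ℝ) ≤ (A : ℝ) := by exact_mod_cast hA0
    linarith
  unfold jbBlock
  rw [Int.cast_max]
  refine max_le hA.le ?_
  by_cases hK : K = 0
  · subst hK; simp; exact hg
  · have hK1 : 1 ≤ K := Nat.one_le_iff_ne_zero.2 hK
    have hne : ((K : ℕ) : ℤ) ≠ 0 := by exact_mod_cast hK
    rw [if_neg hne]; push_cast; exact hP hK1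

/-- **Assembly.**  Base band `bs`, bands `b1 b2 b3` of the other three deep directions in azimuthal
order at scaled azimuths `0 < s1 ≤ s2 ≤ s3 < S4 = 2π·10⁴`, `kᵢ` levels in the four deep arcs
(`Σ kᵢ = 5`).  If the consecutive deep gaps exceed the `jbTA` thresholds, every deep arc `[j, j')`
containing levels is at least `jbTC j + jbTC j' + (K - 1) jbTLL` long, the weighted level cycle gives
`jbRA < 2π·10⁴`, and the tuple check `jbTupleOK` is true, then `False`. -/
theorem jb_assembly (bs b1 b2 b3 k0 k1 k2 k3 : ℕ) (s1 s2 s3 : ℝ) (hk0 : k0 < 6) (hk1 : k1 < 6)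
    (hk2 : k2 < 6) (hk3 : k3 = 5 - (k0 + k1 + k2)) (hsum : k0 + k1 + k2 ≤ 5)
    (hcheck : jbTupleOK bs b1 b2 b3 = true)
    (hA0 : ((jbTA bs b1 : ℕ) : ℝ) < s1) (hA1 : ((jbTA b1 b2 : ℕ) : ℝ) < s2 - s1)
    (hA2 : ((jbTA b2 b3 : ℕ) : ℝ) < s3 - s2) (hA3 : ((jbTA b3 bs : ℕ) : ℝ) < 20000 * π - s3)
    (hP01 : 1 ≤ k0 → ((jbTC bs : ℝ) + jbTC b1) + ((k0 : ℝ) - 1) * jbTLL ≤ s1)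
    (hP02 : 1 ≤ k0 + k1 → ((jbTC bs : ℝ) + jbTC b2) + (((k0 + k1 : ℕ) : ℝ) - 1) * jbTLL ≤ s2)
    (hP03 : 1 ≤ k0 + k1 + k2 →
      ((jbTC bs : ℝ) + jbTC b3) + (((k0 + k1 + k2 : ℕ) : ℝ) - 1) * jbTLL ≤ s3)
    (hP04 : 1 ≤ k0 + k1 + k2 + k3 →
      ((jbTC bs : ℝ) + jbTC bs) + (((k0 + k1 + k2 + k3 : ℕ) : ℝ) - 1) * jbTLL ≤ 20000 * π)
    (hP12 : 1 ≤ k1 → ((jbTC b1 : ℝ) + jbTC b2) + ((k1 : ℝ) - 1) * jbTLL ≤ s2 - s1)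
    (hP13 : 1 ≤ k1 + k2 → ((jbTC b1 : ℝ) + jbTC b3) + (((k1 + k2 : ℕ) : ℝ) - 1) * jbTLL ≤ s3 - s1)
    (hP14 : 1 ≤ k1 + k2 + k3 →
      ((jbTC b1 : ℝ) + jbTC bs) + (((k1 + k2 + k3 : ℕ) : ℝ) - 1) * jbTLL ≤ 20000 * π - s1)
    (hP23 : 1 ≤ k2 → ((jbTC b2 : ℝ) + jbTC b3) + ((k2 : ℝ) - 1) * jbTLL ≤ s3 - s2)
    (hP24 : 1 ≤ k2 + k3 → ((jbTC b2 : ℝ) + jbTC bs) + (((k2 + k3 : ℕ) : ℝ) - 1) * jbTLL ≤ 20000 * π - s2)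
    (hP34 : 1 ≤ k3 → ((jbTC b3 : ℝ) + jbTC bs) + ((k3 : ℝ) - 1) * jbTLL ≤ 20000 * π - s3)
    (hRA : ((jbRA (jbTC bs) (jbTC b1) (jbTC b2) (jbTC b3) : ℤ) : ℝ) < 20000 * π) : False := by
  have hpi := Real.pi_lt_d4
  have h2pi : (20000 : ℝ) * π < 62832 := by nlinarith
  have hcase := jbTupleOK_sound bs b1 b2 b3 k0 k1 k2 hk0 hk1 hk2 hsum hcheck
  rw [← hk3] at hcase
  -- abbreviations
  set A0 : ℤ := ((jbTA bs b1 : ℕ) : ℤ) with hA0d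
  set A1 : ℤ := ((jbTA b1 b2 : ℕ) : ℤ) with hA1d
  set A2 : ℤ := ((jbTA b2 b3 : ℕ) : ℤ) with hA2d
  set A3 : ℤ := ((jbTA b3 bs : ℕ) : ℤ) with hA3d
  have nA0 : (0 : ℤ) ≤ A0 := by rw [hA0d]; exact Int.natCast_nonneg _
  have nA1 : (0 : ℤ) ≤ A1 := by rw [hA1d]; exact Int.natCast_nonneg _
  have nA2 : (0 : ℤ) ≤ A2 := by rw [hA2d]; exact Int.natCast_nonneg _
  have nA3 : (0 : ℤ) ≤ A3 := by rw [hA3d]; exact Int.natCast_nonneg _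
  have cA0 : ((A0 : ℤ) : ℝ) = ((jbTA bs b1 : ℕ) : ℝ) := by rw [hA0d]; push_cast; rfl
  have cA1 : ((A1 : ℤ) : ℝ) = ((jbTA b1 b2 : ℕ) : ℝ) := by rw [hA1d]; push_cast; rfl
  have cA2 : ((A2 : ℤ) : ℝ) = ((jbTA b2 b3 : ℕ) : ℝ) := by rw [hA2d]; push_cast; rfl
  have cA3 : ((A3 : ℤ) : ℝ) = ((jbTA b3 bs : ℕ) : ℝ) := by rw [hA3d]; push_cast; rfl
  -- the ten blocks
  have B01 := jbBlock_le A0 k0 (jbTC bs) (jbTC b1) s1 nA0 (by rw [cA0]; exact hA0) hP01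
  have B12 := jbBlock_le A1 k1 (jbTC b1) (jbTC b2) (s2 - s1) nA1 (by rw [cA1]; exact hA1) hP12
  have B23 := jbBlock_le A2 k2 (jbTC b2) (jbTC b3) (s3 - s2) nA2 (by rw [cA2]; exact hA2) hP23
  have B34 := jbBlock_le A3 k3 (jbTC b3) (jbTC bs) (20000 * π - s3) nA3 (by rw [cA3]; exact hA3) hP34
  have B02 := jbBlock_le (A0 + A1) (k0 + k1) (jbTC bs) (jbTC b2) s2 (by positivity)
    (by push_cast; rw [cA0, cA1]; linarith) hP02
  have B03 := jbBlock_le (A0 + A1 + A2) (k0 + k1 + k2) (jbTC bs) (jbTC b3) s3 (by positivity)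
    (by push_cast; rw [cA0, cA1, cA2]; linarith) hP03
  have B04 := jbBlock_le (A0 + A1 + A2 + A3) (k0 + k1 + k2 + k3) (jbTC bs) (jbTC bs) (20000 * π)
    (by positivity) (by push_cast; rw [cA0, cA1, cA2, cA3]; linarith) hP04
  have B13 := jbBlock_le (A1 + A2) (k1 + k2) (jbTC b1) (jbTC b3) (s3 - s1) (by positivity)
    (by push_cast; rw [cA1, cA2]; linarith) hP13
  have B14 := jbBlock_le (A1 + A2 + A3) (k1 + k2 + k3) (jbTC b1) (jbTC bs) (20000 * π - s1)
    (by positivity) (by push_cast; rw [cA1, cA2, cA3]; linarith) hP14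
  have B24 := jbBlock_le (A2 + A3) (k2 + k3) (jbTC b2) (jbTC bs) (20000 * π - s2) (by positivity)
    (by push_cast; rw [cA2, cA3]; linarith) hP24
  rcases hcase with hR | hH | hF
  · have : (62832 : ℝ) ≤ ((jbRA (jbTC bs) (jbTC b1) (jbTC b2) (jbTC b3) : ℤ) : ℝ) := by
      exact_mod_cast hR
    linarith
  · have hH' : (62832 : ℝ) ≤ ((jbHostAll A0 A1 A2 A3 (jbTC bs) (jbTC b1) (jbTC b2) (jbTC b3)
        k0 k1 k2 k3 : ℤ) : ℝ) := by exact_mod_cast hH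
    unfold jbHostAll at hH'
    push_cast at hH' B01 B12 B23 B34
    linarith
  · have hF' : (62832 : ℝ) ≤ ((jbHostF (jbFlag (jbTC b1)) (jbFlag (jbTC b2)) (jbFlag (jbTC b3))
        A0 A1 A2 A3 (jbTC bs) (jbTC b1) (jbTC b2) (jbTC b3) k0 k1 k2 k3 : ℤ) : ℝ) := by
      exact_mod_cast hF
    cases h1 : jbFlag (jbTC b1) <;> cases h2 : jbFlag (jbTC b2) <;> cases h3 : jbFlag (jbTC b3) <;>
      simp only [h1, h2, h3, jbHostF, jbHostAll] at hF' <;> push_cast at hF' B01 B12 B23 B34 B02 B03 B04 B13 B14 B24 <;>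
      linarith

end Summit.Ventures.Crystal3D.Theorems

end
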